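import Summits.CriticalPhenomena.PercolationContinuityZ3.Theorems.PercNearOneGluingNoHeavyLowerTailSahiThreeCopyTwoPointCertsK5Table

/-!
# Sahi's three-function conjecture — `k = 5` certificate checks, entries 300–599

COMPUTATIONAL (`native_decide`, integer arithmetic): the flow-form / face-form certificates of `certTable5` (`…TwoPointCertsK5Table`,
data `…TwoPointCertsK5Data*`) pass `checkEntry5` for the entries 300 ≤ j < 600 (chunks of 60).  Seat `prim-sahi-p1`, generation 61;
`--supports stmt-CriticalPhenomena-4575`. [this work]
-/

namespace Summit.CriticalPhenomena.PercolationContinuityZ3.Theorems.SahiThreeCopy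

/-- ★★ The certificates of `certTable5` pass the exact check — entries 300–359 (by evaluation). [this work] -/
theorem checkChunk5_300 : checkChunk5 certTable5 upList5 (upSetsC 4) arrTab5 300 60 = true := by
  native_decide

/-- ★★ The certificates of `certTable5` pass the exact check — entries 360–419 (by evaluation). [this work] -/
theorem checkChunk5_360 : checkChunk5 certTable5 upList5 (upSetsC 4) arrTab5 360 60 = true := by
  native_decide

/-- ★★ The certificates of `certTable5` pass the exact check — entries 420–479 (by evaluation). [this work] -/
theorem checkChunk5_420 : checkChunk5 certTable5 upList5 (upSetsC 4) arrTab5 420 60 = true := by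
  native_decide

/-- ★★ The certificates of `certTable5` pass the exact check — entries 480–539 (by evaluation). [this work] -/
theorem checkChunk5_480 : checkChunk5 certTable5 upList5 (upSetsC 4) arrTab5 480 60 = true := by
  native_decide

/-- ★★ The certificates of `certTable5` pass the exact check — entries 540–599 (by evaluation). [this work] -/
theorem checkChunk5_540 : checkChunk5 certTable5 upList5 (upSetsC 4) arrTab5 540 60 = true := by
  native_decide


end Summit.CriticalPhenomena.PercolationContinuityZ3.Theorems.SahiThreeCopy
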